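import Summits.NavierStokesRegularity.NavierStokesRegularity.Theorems.ExtremiserTransienceNearExtremalTransienceExtremiserLiouvilleConstantSpeedSlabTools
import Summits.NavierStokesRegularity.NavierStokesRegularity.Theorems.ExtremiserTransienceNearExtremalTransienceExtremiserLiouvilleConstantSpeedAxialWeightEnergy
import Summits.NavierStokesRegularity.NavierStokesRegularity.Theorems.ExtremiserTransienceNearExtremalTransienceExtremiserLiouvilleNewtonAnisotropic
import HarnessLib

/-!
# Crux `ExtremiserTransience.NearExtremalTransience` (stmt-NavierStokesRegularity-21883), line `extremiser_liouville`,
# stub K1b — THE CORRECTOR OF THE AXIAL WINDOW TRUNCATION IS `O(1/R)`: `‖∇π[θ_{R,ρ}(v − c)]‖ ≤ C_η/R` for `ρ ≥ ρ₀(R)`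

`--supports stmt-NavierStokesRegularity-21883` (helper).  Author: prover seat `ns-el-k1b` (g7).  Discharges the hypothesis of
`…ConstantSpeedSlabRate.slabRate_of_corrector_bound` / `…ConstantSpeedSlabKill`.  The defect of the truncated deviation
`θV` (`θ = g(R⁻¹x₂)χ_ρ`, `V = v − c`) splits as `div(θV) = Dθ(V) = f₁ + f₂` with

* the AXIAL part `f₁ = χ_ρ · g′(R⁻¹x₂)·R⁻¹·V₂`, where `V₂ = −‖V‖²/(2c₂)` by constant speed: `|f₁| ≤ (‖g′‖_∞/(2MR))‖V‖²` —
  QUADRATIC in `V`, with per-height mass controlled by the window energy `E₀`; the anisotropic Newton bound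
  (`…NewtonAnisotropic`, `ρ' = 1`) and the weighted axial energy (`…AxialWeightEnergy`: `∫‖V‖²/(1+(x₂−t)²) ≤ 3πE₀`) give
  `‖∇(Γ∗f₁)‖ ≤ (2M‖g′‖_∞ + 3‖g′‖_∞E₀/(4M))/R`;
* the RADIAL part `f₂ = g(R⁻¹x₂)·Dχ_ρ(V)`: `|f₂| ≤ 2MC/ρ`, `∫f₂² ≤ (C/ρ)²·10RE₀` (slab energy), so the isotropic bound
  (`…NewtonGradientBound`, radius `1`) gives `‖∇(Γ∗f₂)‖ ≤ (2MC + C√(10RE₀/4π))/ρ ≤ 1/R` once `ρ ≥ ρ₀(R)`.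

* `slabCorrector_bound` — **there is `C_η ≥ 0` (explicit: `2M‖g′‖_∞ + 3‖g′‖_∞E₀/(4M) + 1`) such that for every `R ≥ 1`
  there is `ρ₀ ≥ R` with `‖∇π[θ_{R,ρ}(v − c)](y)‖ ≤ C_η/R` for all `ρ ≥ ρ₀` and all `y`.**

WHAT THIS IS NOT: K1b is NOT proved; nothing here proves NS regularity. [folklore]
-/

noncomputable section

open Set Filter Topology MeasureTheory Metric Function Real
open scoped ENNReal NNReal Topology InnerProductSpace RealInnerProductSpace ContDiff

namespace Summit.NavierStokesRegularity.NavierStokesRegularity.Theorems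

-- the problem directory repeats the summit name (`NavierStokesRegularity/NavierStokesRegularity`)
set_option linter.dupNamespace false

namespace ExtremiserLiouville

open Literature.Analysis.FluidPDE Literature.Analysis
open DepletionLadder.KStar DepletionLadder.KStar.HalfSpace

variable {v : E3 → E3} {c : E3}

/-- **Sub-additivity of the Newtonian gradient in the source**: for `φ₁, φ₂ ∈ C^∞_c`,
`‖D(Γ∗(φ₁+φ₂))(y)‖ ≤ ‖D(Γ∗φ₁)(y)‖ + ‖D(Γ∗φ₂)(y)‖`. [folklore] -/
theorem norm_fderiv_newtonPotential_add_le {φ₁ φ₂ : E3 → ℝ} (h₁ : ContDiff ℝ (⊤ : ℕ∞) φ₁) (h₁c : HasCompactSupport φ₁)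
    (h₂ : ContDiff ℝ (⊤ : ℕ∞) φ₂) (h₂c : HasCompactSupport φ₂) (y : E3) :
    ‖fderiv ℝ (fun y => ∫ x, newtonKernel (y - x) * (φ₁ x + φ₂ x)) y‖ ≤
      ‖fderiv ℝ (fun y => ∫ x, newtonKernel (y - x) * φ₁ x) y‖ + ‖fderiv ℝ (fun y => ∫ x, newtonKernel (y - x) * φ₂ x) y‖ := by
  have hsplit : (fun y : E3 => ∫ x, newtonKernel (y - x) * (φ₁ x + φ₂ x)) =
      fun y => (∫ x, newtonKernel (y - x) * φ₁ x) + ∫ x, newtonKernel (y - x) * φ₂ x := by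
    funext y
    simp_rw [mul_add]
    exact integral_add (integrable_newtonKernel_mul h₁.continuous h₁c y) (integrable_newtonKernel_mul h₂.continuous h₂c y)
  have hd₁ : Differentiable ℝ (fun y => ∫ x, newtonKernel (y - x) * φ₁ x) :=
    (contDiff_integral_newtonKernel_mul h₁ h₁c).differentiable (by simp)
  have hd₂ : Differentiable ℝ (fun y => ∫ x, newtonKernel (y - x) * φ₂ x) :=
    (contDiff_integral_newtonKernel_mul h₂ h₂c).differentiable (by simp)
  rw [hsplit]
  show ‖fderiv ℝ ((fun y => ∫ x, newtonKernel (y - x) * φ₁ x) + fun y => ∫ x, newtonKernel (y - x) * φ₂ x) y‖ ≤ _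
  rw [fderiv_add (hd₁ y) (hd₂ y)]
  exact norm_add_le _ _

/-- **THE CORRECTOR BOUND.**  For the constant-speed axial residue JET (`‖v‖ ≡ M = ‖c‖`, `c ∥ e₂`, slabs square integrable,
window energies `≡ E₀`) there is `C_η ≥ 0` such that for every `R ≥ 1` there is `ρ₀ ≥ R` with
`‖∇π[θ_{R,ρ}(v − c)](y)‖ ≤ C_η/R` for all `ρ ≥ ρ₀`, `y ∈ ℝ³`. [folklore] -/
theorem slabCorrector_bound (hv : ContDiff ℝ ∞ v) (hdiv : VectorCalculus.IsDivFree v) {M : ℝ} (hMpos : 0 < M)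
    (hM : ∀ x, ‖v x‖ = M) (hcM : ‖c‖ = M) (hc0 : c 0 = 0) (hc1 : c 1 = 0) (hc2 : c 2 ≠ 0)
    (hslab : ∀ T : ℝ, 0 < T → Integrable (fun x => {x : E3 | |x 2| ≤ T}.indicator (fun x => ‖v x - c‖ ^ 2) x) volume)
    {E₀ : ℝ} (hE0 : 0 ≤ E₀) (hE : ∀ s : ℝ, (∫ x, deriv Real.smoothTransition (x 2 - s) * ‖v x - c‖ ^ 2) = E₀) :
    ∃ Cη : ℝ, 0 ≤ Cη ∧ ∀ R : ℝ, 1 ≤ R → ∃ ρ₀ : ℝ, R ≤ ρ₀ ∧ ∀ ρ : ℝ, ρ₀ ≤ ρ → ∀ y : E3,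
      ‖gradient (divPotential (fun x : E3 =>
          (Real.smoothTransition (4 * (R⁻¹ * x 2) - 1) * Real.smoothTransition (4 - R⁻¹ * x 2 / 2) * cutoff ρ x) •
            (v x - c))) y‖ ≤ Cη / R := by
  -- the profile and its derivative bound
  set g : ℝ → ℝ := fun t : ℝ => Real.smoothTransition (4 * t - 1) * Real.smoothTransition (4 - t / 2) with hgdef
  have hg : ContDiff ℝ ∞ g := axialProfile_contDiff
  have hgc : HasCompactSupport g := axialProfile_hasCompactSupport
  have hg' : ContDiff ℝ ∞ (deriv g) := (contDiff_infty_iff_deriv.1 hg).2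
  obtain ⟨Kg, hKg⟩ := (hg.continuous_deriv (by simp)).bounded_above_of_compact_support hgc.deriv
  have hKg0 : 0 ≤ Kg := (norm_nonneg _).trans (hKg 0)
  obtain ⟨C, hC0, hC⟩ := exists_norm_fderiv_cutoff_le (E := E3)
  -- data of the residue
  set V : E3 → E3 := fun x => v x - c with hVdef
  have hV : ContDiff ℝ ∞ V := hv.sub contDiff_const
  have cV : Continuous V := hV.continuous
  have hVd : Differentiable ℝ V := hV.differentiable (by simp)
  have hVdiv : VectorCalculus.IsDivFree V := isDivFree_sub_const hdiv c
  have hV2M : ∀ x, ‖V x‖ ≤ 2 * M := fun x => by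
    calc ‖v x - c‖ ≤ ‖v x‖ + ‖c‖ := norm_sub_le _ _
      _ = 2 * M := by rw [hM x, hcM]; ring
  -- the axial component is quadratic: `|V₂| ≤ ‖V‖²/(2M)`
  have hc2M : |c 2| = M := by
    have h := EuclideanSpace.norm_eq c
    rw [Fin.sum_univ_three, hc0, hc1, norm_zero] at h
    simp only [ne_eq, OfNat.ofNat_ne_zero, not_false_eq_true, zero_pow, zero_add, Real.norm_eq_abs] at h
    rw [hcM, Real.sqrt_sq_eq_abs, abs_abs] at h
    exact h.symm
  have hV2 : ∀ x, |V x 2| ≤ ‖V x‖ ^ 2 / (2 * M) := by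
    intro x
    have h := inner_excess_eq_of_constSpeed hM hcM x
    have hinner : ⟪v x - c, c⟫ = V x 2 * c 2 := by
      simp only [hVdef, PiLp.inner_apply, RCLike.inner_apply, conj_trivial, Fin.sum_univ_three, hc0, hc1]
      ring
    rw [hinner] at h
    have habs : |V x 2| * M = ‖v x - c‖ ^ 2 / 2 := by
      rw [← hc2M, ← abs_mul, h, abs_neg, abs_of_nonneg (by positivity)]
    rw [le_div_iff₀ (by positivity)]
    have : ‖V x‖ = ‖v x - c‖ := rfl
    rw [this]; linarith
  refine ⟨2 * M * Kg + 3 * Kg * E₀ / (4 * M) + 1, by positivity, fun R hR => ?_⟩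
  have hR0 : 0 < R := one_pos.trans_le hR
  -- the radius
  set Tρ : ℝ := 2 * M * C + C * Real.sqrt (10 * R * E₀ / (4 * π)) with hTρ
  have hTρ0 : 0 ≤ Tρ := by rw [hTρ]; positivity
  refine ⟨max R (R * Tρ), le_max_left _ _, fun ρ hρ y => ?_⟩
  have hRρ : R ≤ ρ := (le_max_left _ _).trans hρ
  have hρ0 : 0 < ρ := hR0.trans_le hRρ
  have hρT : R * Tρ ≤ ρ := (le_max_right _ _).trans hρ
  -- the pieces of the cut-off
  set ℓ : E3 →L[ℝ] ℝ := (R⁻¹ : ℝ) • (EuclideanSpace.proj (2 : Fin 3) : E3 →L[ℝ] ℝ) with hℓdef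
  set a : E3 → ℝ := fun x => Real.smoothTransition (4 * (R⁻¹ * x 2) - 1) * Real.smoothTransition (4 - R⁻¹ * x 2 / 2) with hadef
  set b : E3 → ℝ := cutoff ρ with hbdef
  have hagℓ : a = g ∘ ℓ := by
    funext x
    simp only [hadef, hgdef, hℓdef, Function.comp_apply, FunLike.coe_smul, Pi.smul_apply, smul_eq_mul]
    rfl
  have ha : ContDiff ℝ ∞ a := by rw [hagℓ]; exact hg.comp ℓ.contDiff
  have hb : ContDiff ℝ ∞ b := contDiff_cutoff ρ
  have had : Differentiable ℝ a := ha.differentiable (by simp)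
  have hbd : Differentiable ℝ b := hb.differentiable (by simp)
  have ha01 : ∀ x, 0 ≤ a x ∧ a x ≤ 1 := fun x => axialProfile_nonneg_le_one _
  -- the two defects
  set f₁ : E3 → ℝ := fun x => b x * (deriv g (R⁻¹ * x 2) * (R⁻¹ * V x 2)) with hf₁def
  set f₂ : E3 → ℝ := fun x => a x * fderiv ℝ (cutoff ρ) x (V x) with hf₂def
  set G : E3 → E3 := fun x => (a x * b x) • V x with hGdef
  -- `div G = f₁ + f₂`
  have hDa : ∀ x, fderiv ℝ a x (V x) = deriv g (R⁻¹ * x 2) * (R⁻¹ * V x 2) := by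
    intro x
    have h : HasFDerivAt a (deriv g (ℓ x) • ℓ) x := by
      rw [hagℓ]
      exact ((hg.differentiable (by simp)) _).hasDerivAt.comp_hasFDerivAt x ℓ.hasFDerivAt
    rw [h.fderiv, FunLike.coe_smul, Pi.smul_apply, smul_eq_mul]
    simp only [hℓdef, FunLike.coe_smul, Pi.smul_apply, smul_eq_mul]
    rfl
  have hdivG : ∀ x, VectorCalculus.divergence G x = f₁ x + f₂ x := by
    intro x
    have hθd : DifferentiableAt ℝ (fun y => a y * b y) x := (had x).mul (hbd x)
    have hθ' : HasFDerivAt (fun y => a y * b y) (a x • fderiv ℝ b x + b x • fderiv ℝ a x) x :=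
      (had x).hasFDerivAt.mul (hbd x).hasFDerivAt
    rw [hGdef, divergence_smul_apply hθd (hVd x), hVdiv x, mul_zero, zero_add, real_inner_comm, gradient,
      InnerProductSpace.toDual_symm_apply, hθ'.fderiv]
    rw [_root_.add_apply, FunLike.coe_smul, Pi.smul_apply, FunLike.coe_smul, Pi.smul_apply, smul_eq_mul, smul_eq_mul, hDa x]
    simp only [hf₁def, hf₂def, hbdef]
    ring
  -- smoothness and supports of the defects
  have hc2c : ContDiff ℝ ∞ (fun x : E3 => x 2) := (EuclideanSpace.proj (2 : Fin 3) : E3 →L[ℝ] ℝ).contDiff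
  have hf₁s : ContDiff ℝ ∞ f₁ := by
    refine hb.mul ((hg'.comp (contDiff_const.mul hc2c)).mul (contDiff_const.mul (hc2c.comp hV)))
  have hf₁c : HasCompactSupport f₁ := (hasCompactSupport_cutoff (E := E3) hρ0).mul_right
  have hDb : ContDiff ℝ ∞ (fderiv ℝ (cutoff (E := E3) ρ)) := (contDiff_infty_iff_fderiv.1 (contDiff_cutoff ρ)).2
  have hf₂s : ContDiff ℝ ∞ f₂ := ha.mul (hDb.clm_apply hV)
  have hf₂c : HasCompactSupport f₂ := by
    have hK : HasCompactSupport (fun x => fderiv ℝ (cutoff (E := E3) ρ) x (V x)) := by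
      refine ((hasCompactSupport_cutoff (E := E3) hρ0).fderiv (𝕜 := ℝ)).mono fun x hx => ?_
      simp only [mem_support, ne_eq] at hx ⊢
      intro h0; exact hx (by rw [h0, _root_.zero_apply])
    exact hK.mul_left
  -- pointwise bounds
  have hf₁A : ∀ x, |f₁ x| ≤ Kg / (2 * M * R) * ‖V x‖ ^ 2 := by
    intro x
    have hb1 : |b x| ≤ 1 := by rw [abs_of_nonneg (cutoff_nonneg ρ x)]; exact cutoff_le_one ρ x
    have hg1 : |deriv g (R⁻¹ * x 2)| ≤ Kg := by have := hKg (R⁻¹ * x 2); rwa [Real.norm_eq_abs] at this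
    rw [hf₁def]; dsimp only
    rw [abs_mul, abs_mul, abs_mul, abs_of_pos (inv_pos.2 hR0)]
    have h3 : R⁻¹ * |V x 2| ≤ R⁻¹ * (‖V x‖ ^ 2 / (2 * M)) := mul_le_mul_of_nonneg_left (hV2 x) (inv_nonneg.2 hR0.le)
    have h2 : |deriv g (R⁻¹ * x 2)| * (R⁻¹ * |V x 2|) ≤ Kg * (R⁻¹ * (‖V x‖ ^ 2 / (2 * M))) :=
      mul_le_mul hg1 h3 (by positivity) hKg0
    calc |b x| * (|deriv g (R⁻¹ * x 2)| * (R⁻¹ * |V x 2|))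
        ≤ 1 * (Kg * (R⁻¹ * (‖V x‖ ^ 2 / (2 * M)))) := mul_le_mul hb1 h2 (by positivity) zero_le_one
      _ = Kg / (2 * M * R) * ‖V x‖ ^ 2 := by field_simp
  have hf₁sup : ∀ x, |f₁ x| ≤ 2 * M * Kg / R := fun x => by
    calc |f₁ x| ≤ Kg / (2 * M * R) * ‖V x‖ ^ 2 := hf₁A x
      _ ≤ Kg / (2 * M * R) * (2 * M) ^ 2 := by
          gcongr
          exact hV2M x
      _ = 2 * M * Kg / R := by field_simp
  have hDbC : ∀ x, ‖fderiv ℝ (cutoff (E := E3) ρ) x‖ ≤ C / ρ := hC ρ hρ0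
  have hf₂sup : ∀ x, |f₂ x| ≤ 2 * M * C / ρ := by
    intro x
    rw [hf₂def]; dsimp only
    rw [abs_mul, abs_of_nonneg (ha01 x).1]
    calc a x * |fderiv ℝ (cutoff ρ) x (V x)| ≤ 1 * (C / ρ * (2 * M)) := by
          refine mul_le_mul (ha01 x).2 ?_ (abs_nonneg _) zero_le_one
          rw [← Real.norm_eq_abs]
          exact ((fderiv ℝ (cutoff ρ) x).le_opNorm _).trans (mul_le_mul (hDbC x) (hV2M x) (norm_nonneg _) (by positivity))
      _ = 2 * M * C / ρ := by ring
  -- `∫ f₂² ≤ (C/ρ)²·10RE₀`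
  have hslabE := integral_indicator_slab_sq_le hv hdiv hM hcM hc0 hc1 hc2 hslab hE0 hE hR
  have iE : Integrable (fun x => {x : E3 | R / 4 ≤ x 2 ∧ x 2 ≤ 8 * R}.indicator (fun x => ‖v x - c‖ ^ 2) x) volume := by
    have hT0 : 0 < 8 * R := by positivity
    have h8 : -(8 * R) ≤ R / 4 := by linarith
    exact integrable_indicator_slab_mul_sq cV h8 le_rfl (hslab (8 * R) hT0)
  have hf₂sq : (∫ x, f₂ x ^ 2) ≤ (C / ρ) ^ 2 * (10 * R * E₀) := by
    have hpt : ∀ x, f₂ x ^ 2 ≤ (C / ρ) ^ 2 * {x : E3 | R / 4 ≤ x 2 ∧ x 2 ≤ 8 * R}.indicator (fun x => ‖v x - c‖ ^ 2) x := by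
      intro x
      by_cases hx : R / 4 ≤ x 2 ∧ x 2 ≤ 8 * R
      · rw [indicator_of_mem (show x ∈ {x : E3 | R / 4 ≤ x 2 ∧ x 2 ≤ 8 * R} from hx)]
        have h1 : |f₂ x| ≤ C / ρ * ‖V x‖ := by
          rw [hf₂def]; dsimp only
          rw [abs_mul, abs_of_nonneg (ha01 x).1]
          calc a x * |fderiv ℝ (cutoff ρ) x (V x)| ≤ 1 * (C / ρ * ‖V x‖) := by
                refine mul_le_mul (ha01 x).2 ?_ (abs_nonneg _) zero_le_one
                rw [← Real.norm_eq_abs]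
                exact ((fderiv ℝ (cutoff ρ) x).le_opNorm _).trans (mul_le_mul_of_nonneg_right (hDbC x) (norm_nonneg _))
            _ = C / ρ * ‖V x‖ := one_mul _
        have h0 : 0 ≤ C / ρ * ‖V x‖ := by positivity
        calc f₂ x ^ 2 = |f₂ x| ^ 2 := (sq_abs _).symm
          _ ≤ (C / ρ * ‖V x‖) ^ 2 := pow_le_pow_left₀ (abs_nonneg _) h1 2
          _ = (C / ρ) ^ 2 * ‖v x - c‖ ^ 2 := by ring
      · have ha0 : a x = 0 := by
          rcases not_and_or.1 hx with h | h
          · exact axialProfile_eq_zero_of_le (by rw [inv_mul_le_iff₀ hR0]; linarith [not_le.1 h])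
          · exact axialProfile_eq_zero_of_ge (by rw [le_inv_mul_iff₀' hR0]; linarith [not_le.1 h])
        have : f₂ x = 0 := by rw [hf₂def]; dsimp only; rw [ha0, zero_mul]
        rw [this, indicator_of_notMem (show x ∉ {x : E3 | R / 4 ≤ x 2 ∧ x 2 ≤ 8 * R} from hx)]
        simp
    calc (∫ x, f₂ x ^ 2) ≤ ∫ x, (C / ρ) ^ 2 * {x : E3 | R / 4 ≤ x 2 ∧ x 2 ≤ 8 * R}.indicator (fun x => ‖v x - c‖ ^ 2) x :=
          integral_mono_of_nonneg (Eventually.of_forall fun x => sq_nonneg _) (iE.const_mul _) (Eventually.of_forall hpt)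
      _ = (C / ρ) ^ 2 * ∫ x, {x : E3 | R / 4 ≤ x 2 ∧ x 2 ≤ 8 * R}.indicator (fun x => ‖v x - c‖ ^ 2) x := integral_const_mul _ _
      _ ≤ (C / ρ) ^ 2 * (10 * R * E₀) := mul_le_mul_of_nonneg_left hslabE (sq_nonneg _)
  -- the two Newton bounds
  have hη₁ : ‖fderiv ℝ (fun y => ∫ x, newtonKernel (y - x) * f₁ x) y‖ ≤ 2 * M * Kg / R + 3 * Kg * E₀ / (4 * M * R) := by
    have h := norm_fderiv_newtonPotential_le_anisotropic hf₁s hf₁c hf₁sup one_pos y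
    have hw := integral_mul_inv_one_add_sq_le (V := V) cV hslab hE (f := f₁) (A := Kg / (2 * M * R)) (by positivity) hf₁A (y 2)
    simp only [one_pow, mul_one] at h
    calc _ ≤ 2 * M * Kg / R + (2 * π)⁻¹ * ∫ x, |f₁ x| * (1 + (x 2 - y 2) ^ 2)⁻¹ := h
      _ ≤ 2 * M * Kg / R + (2 * π)⁻¹ * (3 * π * (Kg / (2 * M * R)) * E₀) := by gcongr
      _ = 2 * M * Kg / R + 3 * Kg * E₀ / (4 * M * R) := by field_simp; ring
  have hη₂ : ‖fderiv ℝ (fun y => ∫ x, newtonKernel (y - x) * f₂ x) y‖ ≤ 1 / R := by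
    have h := norm_fderiv_newtonPotential_le_of_radius hf₂s hf₂c hf₂sup one_pos y
    have hsq : Real.sqrt ((∫ x, f₂ x ^ 2) / (4 * π * 1)) ≤ C / ρ * Real.sqrt (10 * R * E₀ / (4 * π)) := by
      rw [mul_one, ← Real.sqrt_sq (by positivity : 0 ≤ C / ρ), ← Real.sqrt_mul (sq_nonneg _)]
      refine Real.sqrt_le_sqrt ?_
      rw [div_le_iff₀ (by positivity)]
      calc (∫ x, f₂ x ^ 2) ≤ (C / ρ) ^ 2 * (10 * R * E₀) := hf₂sq
        _ = (C / ρ) ^ 2 * (10 * R * E₀ / (4 * π)) * (4 * π) := by field_simp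
    calc _ ≤ 2 * M * C / ρ * 1 + Real.sqrt ((∫ x, f₂ x ^ 2) / (4 * π * 1)) := h
      _ ≤ 2 * M * C / ρ + C / ρ * Real.sqrt (10 * R * E₀ / (4 * π)) := by rw [mul_one]; gcongr
      _ = Tρ / ρ := by rw [hTρ]; ring
      _ ≤ 1 / R := by
          rw [div_le_div_iff₀ hρ0 hR0, one_mul, mul_comm]
          exact hρT
  -- assemble
  have hpN : divPotential G = fun y => ∫ x, newtonKernel (y - x) * (f₁ x + f₂ x) := by
    funext y; rw [divPotential_apply]
    exact integral_congr_ae (Eventually.of_forall fun x => by simp only [hdivG])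
  have e : gradient (divPotential G) y = (InnerProductSpace.toDual ℝ E3).symm (fderiv ℝ (divPotential G) y) := rfl
  rw [e, LinearIsometryEquiv.norm_map, hpN]
  calc ‖fderiv ℝ (fun y => ∫ x, newtonKernel (y - x) * (f₁ x + f₂ x)) y‖
      ≤ ‖fderiv ℝ (fun y => ∫ x, newtonKernel (y - x) * f₁ x) y‖ + ‖fderiv ℝ (fun y => ∫ x, newtonKernel (y - x) * f₂ x) y‖ :=
        norm_fderiv_newtonPotential_add_le hf₁s hf₁c hf₂s hf₂c y
    _ ≤ (2 * M * Kg / R + 3 * Kg * E₀ / (4 * M * R)) + 1 / R := add_le_add hη₁ hη₂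
    _ = (2 * M * Kg + 3 * Kg * E₀ / (4 * M) + 1) / R := by rw [← div_div, ← add_div, ← add_div]

end ExtremiserLiouville

end Summit.NavierStokesRegularity.NavierStokesRegularity.Theorems

end
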